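import Summits.AtomisticToContinuum.FouriersLaw.Theorems.BondHeatUncertaintySubdiffusiveBondHeatSpectralNonneg
import Mathlib.Analysis.Fourier.RiemannLebesgueLemma

/-!
# The Warburg-dip ceiling is sharp: `M_N(ω) → 1 − E_N` as `ω → ∞` (Riemann–Lebesgue)

Crux `stmt-AtomisticToContinuum-9120` (`BondHeatUncertainty.SubdiffusiveBondHeat`, (S)), line `bath-bond-deficit-integral` (lead c5).
Notation VERBATIM the `let K / E` of route `BoundaryEscapeDeficit`; `M_N(ω) = (γ/T²)∫_{(0,∞)}(1 − cos ωu)K_N(u)du`.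

* `tendsto_integral_Ioi_cos_mul_atTop` — Riemann–Lebesgue for the cosine transform on `(0,∞)`: for `g ∈ L¹(0,∞)`,
  `∫_{(0,∞)} cos(ωu) g(u) du → 0` as `ω → ∞` (from Mathlib's `Real.tendsto_integral_exp_smul_cocompact`);
* `pinnedChain_warburgDip_tendsto` — **`M_N(ω) → (γ/T²)∫_{(0,∞)}K_N = 1 − E_N` as `ω → ∞`**, every `N ≥ 1`: together with the landed
  ceiling `M_N(ω) ≤ 1 − E_N` (`pinnedChain_warburgDip_le`, from the nonnegativity of the boundary noise spectrum) this says the ceiling is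
  SHARP — `sup_ω M_N(ω) = 1 − E_N` — as seen numerically (lead c5 MD, kit j025387: `max_{ω>1} M_128 = 0.78 ± 0.06` vs `1 − E_128 = 0.79`);
  `warburgDip_tendsto` — the same in the route's `dite` spelling, every `N : ℕ`.

Fixed-`N` facts; nothing here closes the item.
-/

noncomputable section

open MeasureTheory Set Filter Topology
open scoped FourierTransform

namespace Summit.AtomisticToContinuum.FouriersLaw.Theorems.SubdiffusiveBondHeat

open Literature.MathematicalPhysics.KineticTheory.HeatConduction

/-! ### Riemann–Lebesgue for the cosine transform on `(0,∞)` -/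

/-- **Riemann–Lebesgue, cosine transform on `(0,∞)`**: for `g` integrable on `(0,∞)`,
`∫_{(0,∞)} cos(ωu) g(u) du → 0` as `ω → +∞`. [folklore] -/
theorem tendsto_integral_Ioi_cos_mul_atTop {g : ℝ → ℝ} (hg : IntegrableOn g (Ioi 0)) :
    Tendsto (fun ω : ℝ => ∫ u in Ioi (0 : ℝ), Real.cos (ω * u) * g u) atTop (𝓝 0) := by
  -- the integrable function on `ℝ`, complexified
  set f : ℝ → ℂ := fun v => (((Ioi (0 : ℝ)).indicator g v : ℝ) : ℂ) with hf
  have hgi : Integrable ((Ioi (0 : ℝ)).indicator g) := hg.integrable_indicator measurableSet_Ioi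
  have hfi : Integrable f := hgi.ofReal
  -- Riemann–Lebesgue along `cocompact ℝ`, hence along `atTop`, at the rescaled frequency `ω/(2π)`
  have hRL := Real.tendsto_integral_exp_smul_cocompact f
  have hscale : Tendsto (fun ω : ℝ => ω / (2 * Real.pi)) atTop (cocompact ℝ) := by
    have h1 : Tendsto (fun ω : ℝ => ω / (2 * Real.pi)) atTop atTop :=
      Tendsto.atTop_div_const (by positivity) tendsto_id
    exact h1.mono_right (by rw [cocompact_eq_atBot_atTop]; exact le_sup_right)
  have hG := hRL.comp hscale
  -- take real parts
  have hre := (Complex.continuous_re.tendsto 0).comp hG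
  simp only [Complex.zero_re] at hre
  refine hre.congr fun ω => ?_
  simp only [Function.comp_apply]
  -- the character as a continuous complex-valued function of `v`
  have hchar : Continuous fun v : ℝ => ((𝐞 (-(v * (ω / (2 * Real.pi))))) : ℂ) :=
    continuous_subtype_val.comp (Real.continuous_fourierChar.comp ((continuous_id.mul continuous_const).neg))
  -- integrability of the twisted integrand
  have hsm : ∀ v : ℝ, (𝐞 (-(v * (ω / (2 * Real.pi)))) • f v) = (𝐞 (-(v * (ω / (2 * Real.pi)))) : ℂ) * f v := by
    intro v
    rw [Circle.smul_def, smul_eq_mul]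
  have hint : Integrable fun v : ℝ => 𝐞 (-(v * (ω / (2 * Real.pi)))) • f v := by
    simp_rw [hsm]
    refine hfi.bdd_mul (c := 1) hchar.aestronglyMeasurable (Eventually.of_forall fun v => ?_)
    simp
  have hcomm := Complex.reCLM.integral_comp_comm hint
  simp only [Complex.reCLM_apply] at hcomm
  rw [← hcomm, ← integral_indicator measurableSet_Ioi]
  refine integral_congr_ae (Eventually.of_forall fun v => ?_)
  -- pointwise: `re (𝐞(-v w) • f v) = 1_{(0,∞)}(v) cos(ω v) g v`
  have harg' : (2 * Real.pi * -(v * (ω / (2 * Real.pi))) : ℝ) = -(ω * v) := by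
    field_simp
  have harg : ((2 * Real.pi * -(v * (ω / (2 * Real.pi))) : ℝ) : ℂ) = ((-(ω * v) : ℝ) : ℂ) := by
    rw [harg']
  dsimp only
  rw [hsm, Real.fourierChar_apply, harg, Complex.exp_mul_I, ← Complex.ofReal_cos, ← Complex.ofReal_sin]
  simp only [hf, Set.indicator]
  split_ifs with hv
  · simp only [Complex.add_re, Complex.mul_re, Complex.ofReal_re, Complex.ofReal_im,
      Complex.I_re, Complex.I_im, Real.cos_neg]
    ring
  · simp

/-! ### The boundary kernel -/

section FixedN

variable {ω₂ lam β γ T : ℝ} (hω : 0 < ω₂) (hl : 0 < lam) (hβ : 0 < β) (hγ : 0 < γ) (hT : 0 < T) {N : ℕ}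
  (hN : 0 < N)
include hω hl hβ hγ hT hN

/-- **`M_N(ω) → 1 − E_N` as `ω → ∞`** (`N ≥ 1`): the Warburg dip `(γ/T²)∫_{(0,∞)}(1 − cos ωu)K_N(u)du` tends to
`(γ/T²)∫_{(0,∞)}K_N = 1 − E_N` — Riemann–Lebesgue for `K_N ∈ L¹(0,∞)` (`BoundaryKernelBasics`).  With the landed ceiling
`pinnedChain_warburgDip_le` the bound `M_N(ω) ≤ 1 − E_N` is therefore SHARP. [folklore] -/
theorem pinnedChain_warburgDip_tendsto :
    Tendsto (fun ω : ℝ => γ / T ^ 2 * (∫ u in Ioi (0 : ℝ), (1 - Real.cos (ω * u)) *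
        ∫ z, ((z.2 ⟨0, hN⟩) ^ 2 - T) *
            (∫ y, ((y.2 ⟨0, hN⟩) ^ 2 - T) ∂((pinnedChain ω₂ lam β γ).transitionKernel N T T u.toNNReal z))
          ∂((pinnedChain ω₂ lam β γ).gibbsMeasure N T))) atTop
      (𝓝 (γ / T ^ 2 * ∫ u in Ioi (0 : ℝ),
        ∫ z, ((z.2 ⟨0, hN⟩) ^ 2 - T) *
            (∫ y, ((y.2 ⟨0, hN⟩) ^ 2 - T) ∂((pinnedChain ω₂ lam β γ).transitionKernel N T T u.toNNReal z))
          ∂((pinnedChain ω₂ lam β γ).gibbsMeasure N T))) := by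
  obtain ⟨-, hKc, -, -, hKi⟩ := boundaryKernelBasics_proof ω₂ lam β γ hω hl hβ hγ T hT N hN
  simp only [dif_pos hN] at hKc hKi
  set K : ℝ → ℝ := fun u => ∫ z, ((z.2 ⟨0, hN⟩) ^ 2 - T) *
      (∫ y, ((y.2 ⟨0, hN⟩) ^ 2 - T) ∂((pinnedChain ω₂ lam β γ).transitionKernel N T T u.toNNReal z))
    ∂((pinnedChain ω₂ lam β γ).gibbsMeasure N T) with hK
  have hgi : ∀ ω : ℝ, IntegrableOn (fun u : ℝ => Real.cos (ω * u) * K u) (Ioi 0) := by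
    intro ω
    have hcc : Continuous fun u : ℝ => Real.cos (ω * u) := by fun_prop
    refine Integrable.bdd_mul (c := 1) hKi hcc.aestronglyMeasurable.restrict (Eventually.of_forall fun u => ?_)
    rw [Real.norm_eq_abs]; exact Real.abs_cos_le_one _
  have hsplit : ∀ ω : ℝ, ∫ u in Ioi (0 : ℝ), (1 - Real.cos (ω * u)) * K u =
      (∫ u in Ioi (0 : ℝ), K u) - ∫ u in Ioi (0 : ℝ), Real.cos (ω * u) * K u := by
    intro ω
    rw [← integral_sub hKi (hgi ω)]
    refine integral_congr_ae (Eventually.of_forall fun u => ?_)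
    ring
  show Tendsto (fun ω : ℝ => γ / T ^ 2 * (∫ u in Ioi (0 : ℝ), (1 - Real.cos (ω * u)) * K u)) atTop
    (𝓝 (γ / T ^ 2 * ∫ u in Ioi (0 : ℝ), K u))
  simp_rw [hsplit]
  have h0 := tendsto_integral_Ioi_cos_mul_atTop hKi
  have h1 : Tendsto (fun ω : ℝ => (∫ u in Ioi (0 : ℝ), K u) - ∫ u in Ioi (0 : ℝ), Real.cos (ω * u) * K u) atTop
      (𝓝 ((∫ u in Ioi (0 : ℝ), K u) - 0)) := tendsto_const_nhds.sub h0
  rw [sub_zero] at h1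
  exact h1.const_mul _

end FixedN

/-- **`M_N(ω) → 1 − E_N`, `dite` spelling** (every `N : ℕ`; for `N = 0` both sides are the junk `0`). [folklore] -/
theorem warburgDip_tendsto :
    ∀ ω₂ lam β γ : ℝ, 0 < ω₂ → 0 < lam → 0 < β → 0 < γ → ∀ T : ℝ, 0 < T → ∀ N : ℕ, Filter.Tendsto (fun ω : ℝ => γ / T ^ 2 * (∫ u in Set.Ioi (0 : ℝ), (1 - Real.cos (ω * u)) * (if h : 0 < N then ∫ z, ((z.2 ⟨0, h⟩) ^ 2 - T) * (∫ y, ((y.2 ⟨0, h⟩) ^ 2 - T) ∂((Literature.MathematicalPhysics.KineticTheory.HeatConduction.pinnedChain ω₂ lam β γ).transitionKernel N T T u.toNNReal z)) ∂((Literature.MathematicalPhysics.KineticTheory.HeatConduction.pinnedChain ω₂ lam β γ).gibbsMeasure N T) else 0))) Filter.atTop (nhds (γ / T ^ 2 * ∫ u in Set.Ioi (0 : ℝ), (if h : 0 < N then ∫ z, ((z.2 ⟨0, h⟩) ^ 2 - T) * (∫ y, ((y.2 ⟨0, h⟩) ^ 2 - T) ∂((Literature.MathematicalPhysics.KineticTheory.HeatConduction.pinnedChain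 ω₂ lam β γ).transitionKernel N T T u.toNNReal z)) ∂((Literature.MathematicalPhysics.KineticTheory.HeatConduction.pinnedChain ω₂ lam β γ).gibbsMeasure N T) else 0))) := by
  intro ω₂ lam β γ hω hl hβ hγ T hT N
  rcases Nat.eq_zero_or_pos N with rfl | hN
  · simp_rw [dif_neg (lt_irrefl (0 : ℕ)), mul_zero, integral_zero]
    exact tendsto_const_nhds
  · simp only [dif_pos hN]
    exact pinnedChain_warburgDip_tendsto hω hl hβ hγ hT hN

end Summit.AtomisticToContinuum.FouriersLaw.Theorems.SubdiffusiveBondHeat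

end
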